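import Mathlib
import Summits.KontsevichZagierPeriods.KontsevichZagierPeriods.Theorems.SoloInformedKappaOmega
import Literature.NumberTheory.Transcendental.CurvePeriodsPathHomotopicProofs
import HarnessLib

/-!
# Solo-informed: homotopy of paths on a curve, the hypotheses (APPROX) and (HI), and `κ`

Session s9 of the soloist line `solo-KontsevichZagierPeriods-informed` (file J2 of the Rung-2 plan,
`paper/rung2-v2.md` §4.4–4.5). The two geometric inputs of the `κ`-side of Rung 2 are isolated as
named statements, and the functional `κ` on ALL Huber–Wüstholz period symbols is defined from them:

* `SoloInformedHomotopic γ₀ γ₁` — the `C¹` paths `γ₀, γ₁` on `Z` agree on `[0, 1]` with two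
  continuous paths in `Z(ℂ)` between the same points which are homotopic with fixed end points
  (Mathlib's `Path.Homotopic` in the subspace `Z(ℂ)`, the format of the tree's
  `CurvePeriods.span_single_sub_single_of_homotopic`); an equivalence relation.
* `SoloInformedNashApprox` — (APPROX) every `C¹` path on a smooth affine curve over `ℚ̄` with
  algebraic end points is homotopic, with fixed end points, to a NASH path (file B).
* `SoloInformedNashHI` — (HI) `κ̃(Z, ω, γ) = κ̃(Z, ω, γ′)` for homotopic Nash paths `γ ~ γ′`.
* `soloInformedKappa hA s := κ̃(Z, ω, N(Z, γ))` for the Nash replacement `N(Z, γ) ~ γ` chosen once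
  and for all from (APPROX); under (HI) it agrees with `κ̃` on Nash symbols
  (`soloInformedKappa_eq_kappaTilde`), is homotopy invariant (`soloInformedKappa_homotopic`), and
  inherits (R1a), (R1b), (R2) from file J1.

References: Huber–Wüstholz 2022, §3.3.1 and Ch. 12–13 [HuberWuestholz2022]; Kontsevich–Zagier 2001
§1.2 [KontsevichZagier2001].
-/

noncomputable section

open scoped unitInterval
open MeasureTheory Set MvPolynomial
open Literature.NumberTheory.Transcendental Literature.NumberTheory.Transcendental.KZ
open Literature.NumberTheory.Transcendental.CurvePeriods

namespace Summit.KontsevichZagierPeriods.KontsevichZagierPeriods.Theorems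

/-! ## 1. Homotopy with fixed end points between `C¹` paths on a curve -/

/-- **`γ₀ ~ γ₁`**: the `C¹` paths `γ₀, γ₁` on `Z` agree on `[0, 1]` with continuous paths
`p₀, p₁ : Path x y` in `Z(ℂ)` which are homotopic with fixed end points.
[Huber–Wüstholz 2022, §3.3.1] -/
def SoloInformedHomotopic {Z : CurveData} (γ₀ γ₁ : CurvePath Z) : Prop :=
  ∃ (x y : Z.points) (p₀ p₁ : Path x y), (∀ t : I, γ₀.toFun t = p₀ t) ∧
    (∀ t : I, γ₁.toFun t = p₁ t) ∧ p₀.Homotopic p₁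

namespace SoloInformedHomotopic

variable {Z : CurveData}

/-- Reflexivity. -/
theorem refl (γ : CurvePath Z) : SoloInformedHomotopic γ γ :=
  ⟨γ.src, γ.tgt, γ.toPath, γ.toPath, γ.toFun_eq_toPath, γ.toFun_eq_toPath,
    Path.Homotopic.refl _⟩

/-- Two `C¹` paths agreeing on `[0, 1]` are homotopic. -/
theorem of_eqOn {γ₀ γ₁ : CurvePath Z} (h : ∀ t ∈ Icc (0 : ℝ) 1, γ₁.toFun t = γ₀.toFun t) :
    SoloInformedHomotopic γ₀ γ₁ :=
  ⟨γ₀.src, γ₀.tgt, γ₀.toPath, γ₀.toPath, γ₀.toFun_eq_toPath,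
    fun t => (h t t.2).trans (γ₀.toFun_eq_toPath t), Path.Homotopic.refl _⟩

/-- Symmetry. -/
theorem symm {γ₀ γ₁ : CurvePath Z} (h : SoloInformedHomotopic γ₀ γ₁) :
    SoloInformedHomotopic γ₁ γ₀ := by
  obtain ⟨x, y, p₀, p₁, h₀, h₁, hp⟩ := h
  exact ⟨x, y, p₁, p₀, h₁, h₀, hp.symm⟩

/-- Transitivity. -/
theorem trans {γ₀ γ₁ γ₂ : CurvePath Z} (h : SoloInformedHomotopic γ₀ γ₁)
    (h' : SoloInformedHomotopic γ₁ γ₂) : SoloInformedHomotopic γ₀ γ₂ := by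
  obtain ⟨x, y, p₀, p₁, h₀, h₁, hp⟩ := h
  obtain ⟨x', y', q₁, q₂, h₁', h₂', hq⟩ := h'
  have hx : x' = x := Subtype.ext (by
    rw [← q₁.source, ← p₁.source]; exact (h₁' 0).symm.trans (h₁ 0))
  have hy : y' = y := Subtype.ext (by
    rw [← q₁.target, ← p₁.target]; exact (h₁' 1).symm.trans (h₁ 1))
  subst hx hy
  have hq₁ : q₁ = p₁ := Path.ext (funext fun t => Subtype.ext ((h₁' t).symm.trans (h₁ t)))
  refine ⟨x', y', p₀, q₂, h₀, h₂', hp.trans ?_⟩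
  rw [← hq₁]
  exact hq

/-- The initial points of homotopic paths agree. -/
theorem toFun_zero {γ₀ γ₁ : CurvePath Z} (h : SoloInformedHomotopic γ₀ γ₁) :
    γ₀.toFun 0 = γ₁.toFun 0 := by
  obtain ⟨x, y, p₀, p₁, h₀, h₁, -⟩ := h
  have a := h₀ 0
  have b := h₁ 0
  simp only [Icc.coe_zero, Path.source] at a b
  rw [a, b]

/-- The end points of homotopic paths agree. -/
theorem toFun_one {γ₀ γ₁ : CurvePath Z} (h : SoloInformedHomotopic γ₀ γ₁) :
    γ₀.toFun 1 = γ₁.toFun 1 := by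
  obtain ⟨x, y, p₀, p₁, h₀, h₁, -⟩ := h
  have a := h₀ 1
  have b := h₁ 1
  simp only [Icc.coe_one, Path.target] at a b
  rw [a, b]

end SoloInformedHomotopic

/-! ## 2. The two geometric hypotheses -/

/-- **(APPROX) Nash replacement.** On a smooth affine curve over `ℚ̄`, every `C¹` path with
algebraic end points is homotopic, with fixed end points in `Z(ℂ)`, to a Nash path (a `C¹` path on
a neighbourhood of `[0, 1]` whose coordinates have `ℚ`-semialgebraic real and imaginary parts).
Plan: Lebesgue number of the cover by Nash chart images along the path, algebraic points of `Z`
near the division points, chart segments. [paper/rung2-v2.md §4.4; Huber–Wüstholz 2022, §3.3.1] -/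
def SoloInformedNashApprox : Prop :=
  ∀ (Z : CurveData), Z.IsSmoothAffineCurve → ∀ γ : CurvePath Z,
    ∃ γ' : CurvePath Z, SoloInformedIsNashPath γ'.toFun ∧ SoloInformedHomotopic γ γ'

/-- **(HI) Homotopy invariance of `κ̃`.** For Nash paths `γ ~ γ′` on a smooth affine curve over
`ℚ̄` (homotopic with fixed end points through a continuous homotopy in `Z(ℂ)`) and an algebraic
`1`-form `ω`, `κ̃(Z, ω, γ) = κ̃(Z, ω, γ′)` in `V`. Plan: grid of Nash chart cells, Kontsevich–Zagier
Stokes on Nash rectangles for the closed forms `Re/Im ψ^*ω`, telescoping.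
[paper/rung2-v2.md §4.5; Kontsevich–Zagier 2001 §1.2] -/
def SoloInformedNashHI : Prop :=
  ∀ (Z : CurveData) (hZ : Z.IsSmoothAffineCurve) (ω : Fin Z.n → MvPolynomial (Fin Z.n) ℂ)
    (hω : ∀ i, HasAlgCoeffs (ω i)) (γ γ' : CurvePath Z) (h : SoloInformedIsNashPath γ.toFun)
    (h' : SoloInformedIsNashPath γ'.toFun), SoloInformedHomotopic γ γ' →
    soloInformedKappaTilde ⟨Z, hZ, ω, hω, γ⟩ h = soloInformedKappaTilde ⟨Z, hZ, ω, hω, γ'⟩ h'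

/-! ## 3. The Nash replacement and the functional `κ` -/

/-- The Nash replacement `N(Z, γ) ~ γ` chosen from (APPROX). -/
def soloInformedNashRepl (hA : SoloInformedNashApprox) {Z : CurveData} (hZ : Z.IsSmoothAffineCurve)
    (γ : CurvePath Z) : CurvePath Z :=
  (hA Z hZ γ).choose

/-- `N(Z, γ)` is a Nash path. -/
theorem soloInformedNashRepl_nash (hA : SoloInformedNashApprox) {Z : CurveData}
    (hZ : Z.IsSmoothAffineCurve) (γ : CurvePath Z) :
    SoloInformedIsNashPath (soloInformedNashRepl hA hZ γ).toFun :=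
  (hA Z hZ γ).choose_spec.1

/-- `γ ~ N(Z, γ)`. -/
theorem soloInformedNashRepl_homotopic (hA : SoloInformedNashApprox) {Z : CurveData}
    (hZ : Z.IsSmoothAffineCurve) (γ : CurvePath Z) :
    SoloInformedHomotopic γ (soloInformedNashRepl hA hZ γ) :=
  (hA Z hZ γ).choose_spec.2

/-- **The functional `κ` on all period symbols**: `κ(Z, ω, γ) := κ̃(Z, ω, N(Z, γ))`.
[paper/rung2-v2.md §4.4] -/
def soloInformedKappa (hA : SoloInformedNashApprox) (s : PeriodSymbol) : SoloInformedV :=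
  soloInformedKappaTilde ⟨s.Z, s.smooth, s.ω, s.ω_algebraic, soloInformedNashRepl hA s.smooth s.γ⟩
    (soloInformedNashRepl_nash hA s.smooth s.γ)

/-- Unfolding `κ` on a symbol given by its fields. -/
theorem soloInformedKappa_mk (hA : SoloInformedNashApprox) (Z : CurveData)
    (hZ : Z.IsSmoothAffineCurve) (ω : Fin Z.n → MvPolynomial (Fin Z.n) ℂ)
    (hω : ∀ i, HasAlgCoeffs (ω i)) (γ : CurvePath Z) :
    soloInformedKappa hA ⟨Z, hZ, ω, hω, γ⟩ =
      soloInformedKappaTilde ⟨Z, hZ, ω, hω, soloInformedNashRepl hA hZ γ⟩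
        (soloInformedNashRepl_nash hA hZ γ) := rfl

/-- **`κ = κ̃` on Nash symbols** (under (HI)). -/
theorem soloInformedKappa_eq_kappaTilde (hA : SoloInformedNashApprox) (hI : SoloInformedNashHI)
    (s : PeriodSymbol) (h : SoloInformedIsNashPath s.γ.toFun) :
    soloInformedKappa hA s = soloInformedKappaTilde s h := by
  obtain ⟨Z, hZ, ω, hω, γ⟩ := s
  exact (hI Z hZ ω hω γ _ h _ (soloInformedNashRepl_homotopic hA hZ γ)).symm

/-- **`κ` is homotopy invariant** (under (HI)). -/
theorem soloInformedKappa_homotopic (hA : SoloInformedNashApprox) (hI : SoloInformedNashHI)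
    (Z : CurveData) (hZ : Z.IsSmoothAffineCurve) (ω : Fin Z.n → MvPolynomial (Fin Z.n) ℂ)
    (hω : ∀ i, HasAlgCoeffs (ω i)) {γ γ' : CurvePath Z} (hh : SoloInformedHomotopic γ γ') :
    soloInformedKappa hA ⟨Z, hZ, ω, hω, γ⟩ = soloInformedKappa hA ⟨Z, hZ, ω, hω, γ'⟩ :=
  hI Z hZ ω hω _ _ _ _ (((soloInformedNashRepl_homotopic hA hZ γ).symm.trans hh).trans
    (soloInformedNashRepl_homotopic hA hZ γ'))

/-- `κ` only depends on the values of the path on `[0, 1]`. -/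
theorem soloInformedKappa_congr_of_eqOn (hA : SoloInformedNashApprox) (hI : SoloInformedNashHI)
    (Z : CurveData) (hZ : Z.IsSmoothAffineCurve) (ω : Fin Z.n → MvPolynomial (Fin Z.n) ℂ)
    (hω : ∀ i, HasAlgCoeffs (ω i)) {γ γ' : CurvePath Z}
    (h : ∀ t ∈ Icc (0 : ℝ) 1, γ'.toFun t = γ.toFun t) :
    soloInformedKappa hA ⟨Z, hZ, ω, hω, γ⟩ = soloInformedKappa hA ⟨Z, hZ, ω, hω, γ'⟩ :=
  soloInformedKappa_homotopic hA hI Z hZ ω hω (SoloInformedHomotopic.of_eqOn h)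

/-! ## 4. (R1a), (R1b), (R2) for `κ` -/

/-- **(R1a) for `κ`**: `κ(Z, ω₁ + ω₂, γ) = κ(Z, ω₁, γ) + κ(Z, ω₂, γ)` (same Nash replacement
`N(Z, γ)` for the three symbols). -/
theorem soloInformedKappa_add_form (hA : SoloInformedNashApprox) (Z : CurveData)
    (hZ : Z.IsSmoothAffineCurve) (γ : CurvePath Z) (ω ω₁ ω₂ : Fin Z.n → MvPolynomial (Fin Z.n) ℂ)
    (h : ∀ i, HasAlgCoeffs (ω i)) (h₁ : ∀ i, HasAlgCoeffs (ω₁ i))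
    (h₂ : ∀ i, HasAlgCoeffs (ω₂ i)) (hω : ω = ω₁ + ω₂) :
    soloInformedKappa hA ⟨Z, hZ, ω, h, γ⟩ =
      soloInformedKappa hA ⟨Z, hZ, ω₁, h₁, γ⟩ + soloInformedKappa hA ⟨Z, hZ, ω₂, h₂, γ⟩ :=
  soloInformedKappaTilde_add_form Z hZ _ _ ω ω₁ ω₂ h h₁ h₂ hω

/-- **(R1b) for `κ`**: `κ(Z, a ω, γ) = a ⋆ κ(Z, ω, γ)` for `a ∈ ℚ̄`. -/
theorem soloInformedKappa_smul_form (hA : SoloInformedNashApprox) (Z : CurveData)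
    (hZ : Z.IsSmoothAffineCurve) (γ : CurvePath Z) (a : SoloInformedCxAlg)
    (ω ω' : Fin Z.n → MvPolynomial (Fin Z.n) ℂ)
    (h : ∀ i, HasAlgCoeffs (ω i)) (h' : ∀ i, HasAlgCoeffs (ω' i)) (hω : ω' = (a : ℂ) • ω) :
    soloInformedKappa hA ⟨Z, hZ, ω', h', γ⟩ = a • soloInformedKappa hA ⟨Z, hZ, ω, h, γ⟩ :=
  soloInformedKappaTilde_smul_form Z hZ _ _ a ω ω' h h' hω

/-- **(R2) for `κ`**: `κ(Z, ω, γ) = 0` if `ω` vanishes on the tangent spaces of `Z`. -/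
theorem soloInformedKappa_eq_zero_of_vanishesOn (hA : SoloInformedNashApprox) (Z : CurveData)
    (hZ : Z.IsSmoothAffineCurve) (γ : CurvePath Z) (ω : Fin Z.n → MvPolynomial (Fin Z.n) ℂ)
    (h : ∀ i, HasAlgCoeffs (ω i)) (hv : VanishesOn Z ω) :
    soloInformedKappa hA ⟨Z, hZ, ω, h, γ⟩ = 0 :=
  soloInformedKappaTilde_eq_zero_of_vanishesOn' Z hZ _ _ ω h hv

end Summit.KontsevichZagierPeriods.KontsevichZagierPeriods.Theorems
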